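import Mathlib

/-!
# Two-time propagator bound from node data (solo-blind s80, R8 of §24.90)

The validated integrator certifies the step propagators of the linearised flow at nodes
`0 = t₀ < t₁ < … < t_N = T` and hence, by ball matrix products, a bound `G` on every node-to-node
propagator `Φ(tᵢ, tⱼ)`, `j ≤ i`; between nodes it certifies a local growth bound `E` (e.g.
`E = exp (2 h μ⁺)` from the log-norm).  This file turns the two into a bound on the full two-time
family: `‖Φ(t, s)‖ ≤ E·G·E` for all `0 ≤ s ≤ t ≤ T`.  This quantity — not `exp Λ̄` — is what the
J-tail and plateau estimates and the periodic solution operator consume.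

* `two_time_bound_of_nodes` — the statement above, for any two-parameter family with the cocycle
  property in a normed ring.
-/

open Set

namespace Summit.AnomalousDissipation.AnomalousDissipation.Theorems

variable {𝔸 : Type*} [NormedRing 𝔸]

/-- **Two-time bound from node bounds.**  Let `Φ t s` satisfy the cocycle identity
`Φ t s = Φ t r * Φ r s` for `0 ≤ s ≤ r ≤ t ≤ T`, a local bound `‖Φ t s‖ ≤ E` whenever
`0 ≤ t - s ≤ 2h`, and a node bound `‖Φ a b‖ ≤ G` for nodes `b ≤ a` of a node set `N ⊆ [0, T]` which
has a node within `h` below every point and within `h` above every point of `[0, T]`.  Then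
`‖Φ t s‖ ≤ E * G * E` for all `0 ≤ s ≤ t ≤ T` (given `1 ≤ E`, `1 ≤ G`). -/
theorem two_time_bound_of_nodes {Φ : ℝ → ℝ → 𝔸} {N : Set ℝ} {T h E G : ℝ}
    (hE : 1 ≤ E) (hG : 1 ≤ G) (hN : N ⊆ Icc 0 T)
    (hcoc : ∀ s r t, 0 ≤ s → s ≤ r → r ≤ t → t ≤ T → Φ t s = Φ t r * Φ r s)
    (hloc : ∀ s t, 0 ≤ s → s ≤ t → t ≤ T → t - s ≤ 2 * h → ‖Φ t s‖ ≤ E)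
    (hbelow : ∀ t ∈ Icc 0 T, ∃ a ∈ N, a ≤ t ∧ t - a ≤ h)
    (habove : ∀ s ∈ Icc 0 T, ∃ b ∈ N, s ≤ b ∧ b - s ≤ h)
    (hnode : ∀ a ∈ N, ∀ b ∈ N, b ≤ a → ‖Φ a b‖ ≤ G) :
    ∀ s t, 0 ≤ s → s ≤ t → t ≤ T → ‖Φ t s‖ ≤ E * G * E := by
  intro s t hs hst htT
  have ht0 : 0 ≤ t := hs.trans hst
  have hsT : s ≤ T := hst.trans htT
  have hE0 : 0 ≤ E := zero_le_one.trans hE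
  obtain ⟨a, haN, hat, hta⟩ := hbelow t ⟨ht0, htT⟩
  obtain ⟨b, hbN, hsb, hbs⟩ := habove s ⟨hs, hsT⟩
  have ha := hN haN
  have hb := hN hbN
  by_cases hba : b ≤ a
  · -- chain through the nodes: Φ t s = Φ t a * (Φ a b * Φ b s)
    have h1 : Φ t s = Φ t a * Φ a s := hcoc s a t hs (hsb.trans hba) hat htT
    have h2 : Φ a s = Φ a b * Φ b s := hcoc s b a hs hsb hba ha.2
    have nta : ‖Φ t a‖ ≤ E := hloc a t ha.1 hat htT (by linarith)
    have nab : ‖Φ a b‖ ≤ G := hnode a haN b hbN hba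
    have nbs : ‖Φ b s‖ ≤ E := hloc s b hs hsb hb.2 (by linarith)
    rw [h1, h2]
    calc ‖Φ t a * (Φ a b * Φ b s)‖ ≤ ‖Φ t a‖ * (‖Φ a b‖ * ‖Φ b s‖) := by
            refine (norm_mul_le _ _).trans ?_
            exact mul_le_mul_of_nonneg_left (norm_mul_le _ _) (norm_nonneg _)
      _ ≤ E * (G * E) := by
            apply mul_le_mul nta (mul_le_mul nab nbs (norm_nonneg _) (zero_le_one.trans hG))
              (mul_nonneg (norm_nonneg _) (norm_nonneg _)) hE0
      _ = E * G * E := by ring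
  · -- no node between: the pair is local
    have hab : a < b := not_le.mp hba
    have hshort : t - s ≤ 2 * h := by linarith
    calc ‖Φ t s‖ ≤ E := hloc s t hs hst htT hshort
      _ = E * 1 * 1 := by ring
      _ ≤ E * G * E := by gcongr
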